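import Mathlib.Analysis.Complex.Exponential
import Mathlib.Analysis.SpecialFunctions.Integrals.Basic
import HarnessLib

/-!
# A certified upper bound for `∫_a^b e^{αs} ds/s` (towards the numerics of Irving 2015, §5)

Eleventh proved layer under the named fact `Irving2015_largestPrimeFactor_cubic`
(`LargestPrimeFactorCubic.lean`; A. J. Irving, arXiv:1412.0024 = Acta Arith. 171 (2015)).
Irving, §4: "The final integral cannot be expressed using elementary functions but it is an
exponential integral which can easily be evaluated by a computer."  For the certified numerics of
his Lemma 4.2 (`Irving2015.irving_lemma_4_2`, `…Tilted.lean`) we need rational UPPER bounds for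
`∫_a^b e^{αs} ds/s`; this file proves the elementary one obtained by integrating the Taylor
polynomial of `e^{αs}` with the remainder bound of Mathlib's `Complex.exp_bound'`
(`‖e^x − ∑_{m<n} x^m/m!‖ ≤ 2‖x‖^n/n!` for `‖x‖ ≤ (n+1)/2`):

* `Irving2015.exp_le_taylor_add` — `e^x ≤ ∑_{m<n} x^m/m! + 2x^n/n!` for `0 ≤ x ≤ (n+1)/2`;
* `Irving2015.integral_exp_div_le_taylor` — for `0 < a ≤ b`, `α ≥ 0`, `n ≥ 1`, `αb ≤ (n+1)/2`:
  `∫_a^b e^{αs} ds/s ≤ log(b/a) + ∑_{j<n-1} α^{j+1}(b^{j+1} − a^{j+1})/((j+1)(j+1)!) + 2α^n(b^n − a^n)/(n·n!)`.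

Everything is PROVED; Mathlib-only imports. [folklore]

## References

* A. J. Irving, *The largest prime factor of `X³ + 2`*, arXiv:1412.0024; Acta Arith. 171 (2015)
  67–80, §4 (Lemma 4.2) and §5. [`Irving2014LargestPrimeFactorCubic`]
-/

noncomputable section

open Finset MeasureTheory intervalIntegral

namespace Literature.NumberTheory.Sieve

namespace Irving2015

/-- `e^x ≤ ∑_{m<n} x^m/m! + 2x^n/n!` for `0 ≤ x`, `x/(n+1) ≤ 1/2` (Mathlib's
`Complex.exp_bound'`, real form). [folklore] -/
theorem exp_le_taylor_add {x : ℝ} (hx0 : 0 ≤ x) {n : ℕ} (hn : x / (n + 1) ≤ 1 / 2) :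
    Real.exp x ≤ (∑ m ∈ range n, x ^ m / m.factorial) + x ^ n / n.factorial * 2 := by
  have hxc : ‖(x : ℂ)‖ / (n.succ : ℕ) ≤ 1 / 2 := by
    rw [Complex.norm_real, Real.norm_eq_abs, abs_of_nonneg hx0]; push_cast; exact hn
  have h : |Real.exp x - ∑ m ∈ range n, x ^ m / m.factorial| ≤ |x| ^ n / n.factorial * 2 := by
    convert Complex.exp_bound' hxc <;> norm_cast
  rw [abs_of_nonneg hx0] at h
  linarith [(abs_sub_le_iff.1 h).1]

/-- **The exponential integral, bounded above by termwise integration**: for `0 < a ≤ b`,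
`α ≥ 0`, `n ≥ 1` and `αb/(n+1) ≤ 1/2`,
`∫_a^b e^{αs} ds/s ≤ log(b/a) + ∑_{j<n-1} α^{j+1}(b^{j+1} − a^{j+1})/((j+1)·(j+1)!) + 2α^n(b^n − a^n)/(n·n!)`.
[folklore] -/
theorem integral_exp_div_le_taylor {α a b : ℝ} (ha : 0 < a) (hab : a ≤ b) (hα : 0 ≤ α) {n : ℕ}
    (hn1 : 1 ≤ n) (hn : α * b / (n + 1) ≤ 1 / 2) :
    ∫ s in a..b, Real.exp (α * s) / s ≤
      Real.log (b / a) +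
        ∑ j ∈ range (n - 1), α ^ (j + 1) * (b ^ (j + 1) - a ^ (j + 1)) / ((j + 1) * (j + 1).factorial) +
        2 * α ^ n * (b ^ n - a ^ n) / (n * n.factorial) := by
  have hb : 0 < b := ha.trans_le hab
  -- the majorant `G`
  set G : ℝ → ℝ := fun s => s⁻¹ + ∑ j ∈ range (n - 1), α ^ (j + 1) / (j + 1).factorial * s ^ j +
    2 * α ^ n / n.factorial * s ^ (n - 1) with hG
  -- pointwise bound on `[a, b]`
  have hpt : ∀ s ∈ Set.Icc a b, Real.exp (α * s) / s ≤ G s := by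
    intro s hs
    have hs0 : 0 < s := ha.trans_le hs.1
    have hx0 : 0 ≤ α * s := mul_nonneg hα hs0.le
    have hxn : α * s / (n + 1) ≤ 1 / 2 := by
      refine le_trans ?_ hn
      exact div_le_div_of_nonneg_right (mul_le_mul_of_nonneg_left hs.2 hα) (by positivity)
    have hexp := exp_le_taylor_add hx0 hxn
    rw [div_le_iff₀ hs0, hG]
    simp only
    -- `G s * s = ∑_{m<n} (αs)^m/m! + 2 (αs)^n/n!`
    have hGs : (s⁻¹ + ∑ j ∈ range (n - 1), α ^ (j + 1) / (j + 1).factorial * s ^ j +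
        2 * α ^ n / n.factorial * s ^ (n - 1)) * s =
        (∑ m ∈ range n, (α * s) ^ m / m.factorial) + (α * s) ^ n / n.factorial * 2 := by
      obtain ⟨n', rfl⟩ : ∃ n', n = n' + 1 := ⟨n - 1, by omega⟩
      simp only [Nat.add_sub_cancel]
      rw [Finset.sum_range_succ' (fun m => (α * s) ^ m / (m.factorial : ℝ))]
      simp only [pow_zero, Nat.factorial_zero, Nat.cast_one, div_one]
      rw [add_mul, add_mul, Finset.sum_mul]
      have e1 : ∀ j ∈ range n', α ^ (j + 1) / ((j + 1).factorial : ℝ) * s ^ j * s =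
          (α * s) ^ (j + 1) / ((j + 1).factorial : ℝ) := by
        intro j _
        rw [mul_pow]; field_simp; ring
      rw [Finset.sum_congr rfl e1]
      have e2 : 2 * α ^ (n' + 1) / ((n' + 1).factorial : ℝ) * s ^ n' * s =
          (α * s) ^ (n' + 1) / ((n' + 1).factorial : ℝ) * 2 := by
        rw [mul_pow]; field_simp; ring
      rw [e2, inv_mul_cancel₀ hs0.ne']
      ring
    rw [hGs]
    exact hexp
  -- integrability
  have hcontf : ContinuousOn (fun s => Real.exp (α * s) / s) (Set.uIcc a b) := by
    refine ContinuousOn.div (Continuous.continuousOn (by continuity)) continuousOn_id fun s hs => ?_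
    rw [Set.uIcc_of_le hab] at hs
    exact (ha.trans_le hs.1).ne'
  have hmemne : ∀ s ∈ Set.uIcc a b, s ≠ 0 := fun s hs => by
    rw [Set.uIcc_of_le hab] at hs; exact (ha.trans_le hs.1).ne'
  have hcontG : ContinuousOn G (Set.uIcc a b) := by
    rw [hG]
    refine ((continuousOn_inv₀.mono fun s hs => hmemne s hs).add ?_).add ?_
    · exact continuousOn_finsetSum _ fun j _ => (continuousOn_const.mul (continuousOn_id.pow _))
    · exact continuousOn_const.mul (continuousOn_id.pow _)
  have hint_f := hcontf.intervalIntegrable (μ := volume)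
  have hint_G := hcontG.intervalIntegrable (μ := volume)
  -- compare the integrals
  have hmono : ∫ s in a..b, Real.exp (α * s) / s ≤ ∫ s in a..b, G s :=
    intervalIntegral.integral_mono_on hab hint_f hint_G hpt
  refine hmono.trans (le_of_eq ?_)
  -- compute `∫ G`
  have hI1 : IntervalIntegrable (fun s : ℝ => s⁻¹) volume a b :=
    (continuousOn_inv₀.mono fun s hs => hmemne s hs).intervalIntegrable
  have hI2 : ∀ j ∈ range (n - 1),
      IntervalIntegrable (fun s : ℝ => α ^ (j + 1) / (j + 1).factorial * s ^ j) volume a b :=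
    fun j _ => (continuousOn_const.mul (continuousOn_id.pow _)).intervalIntegrable
  have hI2' : IntervalIntegrable
      (fun s : ℝ => ∑ j ∈ range (n - 1), α ^ (j + 1) / (j + 1).factorial * s ^ j) volume a b :=
    (continuousOn_finsetSum _ fun j _ =>
      (continuousOn_const.mul (continuousOn_id.pow _))).intervalIntegrable
  have hI3 : IntervalIntegrable (fun s : ℝ => 2 * α ^ n / n.factorial * s ^ (n - 1)) volume a b :=
    (continuousOn_const.mul (continuousOn_id.pow _)).intervalIntegrable
  rw [hG]
  rw [intervalIntegral.integral_add (hI1.add hI2') hI3, intervalIntegral.integral_add hI1 hI2',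
    intervalIntegral.integral_finsetSum hI2, integral_inv_of_pos ha hb]
  simp only [intervalIntegral.integral_const_mul, integral_pow]
  obtain ⟨n', rfl⟩ : ∃ n', n = n' + 1 := ⟨n - 1, by omega⟩
  simp only [Nat.add_sub_cancel]
  congr 1
  · congr 1
    refine Finset.sum_congr rfl fun j _ => ?_
    field_simp
  · push_cast
    field_simp

end Irving2015

end Literature.NumberTheory.Sieve
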